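import Literature.IUT.HodgeTheaters.PuncturedEllipticCoverings
import Literature.AnabelianGeometry.AbsoluteAnabelian.AbsTopII.EllipticCuspidalizationCor33iBiAnabelian
import Literature.AnabelianGeometry.AbsoluteAnabelian.AbsTopIII.BirationalReconstructionAbsoluteProofs
import HarnessLib

/-!
# [IUTchI] Cor 1.2: the Cor 3.3 (i) binders `hext` / `hextC` of the certificate conjunct FROM [AbsTopII] Cor 3.3 (i)
# as typed in layer L4 (F-0294, model-relative) + realisation data — the L4→L5 ADAPTER (proof-only)

S. Mochizuki, *Inter-universal Teichmüller theory I*, kurims manuscript (May 2020), §1, Cor 1.2 p. 39, proof l. 24–27: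
«the algorithms of [AbsTopII], Corollary 3.3, (i), (ii) — which are applicable in light of [AbsTopI], Example 4.8 — allow one
to reconstruct `Π_C` [together with the natural inclusion `Π_{X̲→} ↪ Π_C`]» [claim: Mochizuki2012, status: disputed] (D-0012
claim key; nothing of the series is asserted here); S. Mochizuki, *Topics in Absolute Anabelian Geometry II*, Cor 3.3 (i)
pp. 67–68, Rmk 3.3.2 p. 69 [cite: MochizukiAbsTopII2013, Cor 3.3 (i) p.67]; *… III*, Rmk 1.11.1 (i) p. 47 (an isomorphism of
extensions is determined by its `Π`-component once `Δ` is carried to `Δ`) [cite: MochizukiAbsTopIII2015, Rmk 1.11.1 (i) p.47].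

PROOF-ONLY companion (abc-iut cell; L5 ROWS #5 row R7 «COR12-ABSTOPII-COR33-ADAPTER», seat abc-iut-w6-d032 gen 6; no `def`,
no `instance`; plan/L5/SUBDAG-IUTchI-Cor12.md §A laws 5–6 «ADAPTER»).  The Cor 1.2 certificate conjunct
`Summit.ABC.IUTFork.Conditional.layer5_held_cor12_v6` (and abc-iut-L5-d4's `pe_characteristicNatureOfCoverings_viaX_of_laws`
beneath it) binds

* `hext : ∀ φ : D.geom.pe.piXarrow ≃* D'.geom.pe.piXarrow, Continuous φ → Continuous φ.symm →
    ∃ Θ : D.geom.pe.PiC ≃ₜ* D'.geom.pe.PiC, ∀ x : D.geom.pe.piXarrow, Θ (x : D.geom.pe.PiC) = (φ x : D'.geom.pe.PiC)`,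
* `hextC` — the same with `piCarrow` (`Π_{C̲→}`),

i.e. [AbsTopII] Cor 3.3 (i) in PURE EXTENSION form at the genuine §1 data.  Layer L4 types Cor 3.3 (i) as the printed
MONO-anabelian characterization `AbsTopII.EllipticModel.Cor_3_3_i` relative to a model `(𝒟, M)` (FACT-LIST F-0294; p409138), and
`EllipticCuspidalizationCor33iBiAnabelian.lean` (same seat) derives from it the BI-anabelian core extension
`EllipticModel.exists_coreIso_extending_of_cor_3_3_i` for isomorphisms OF EXTENSIONS of two members.  THIS FILE closes the
remaining gap to the certificate's shape:

* `exists_continuousMulEquiv_extending_of_cor_3_3_i` — for two members `X`, `X′` of `M` REALISED inside ambient topological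
  groups `A ⊇ Q`, `A′ ⊇ Q′` (realisation data: `ePi : Π_X ≃ Q`, `eC : Π_C ≃ A` with `eC ∘ (Π_X ↪ Π_C) = (Q ↪ A) ∘ ePi`, same
  primed), every bicontinuous group isomorphism `φ : Q ≃ Q′` extends to `Θ : A ≃ A′`.  The Galois parts of the two member
  extensions are NOT assumed to be matched by `φ`: `φ` carries `Δ` onto `Δ′` because `Δ ⊆ Π` is the maximal topologically
  finitely generated closed normal subgroup on both sides (`GeomIsMaxTFGNormalIn ⊤`, [AbsAnab] Lem 1.1.4 (i) / [AbsTopI]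
  Thm 2.6 (vi) shape — abc-iut-L4-t6's `geom_map_eq_of_geomIsMaxTFGNormalIn`), whence an isomorphism of extensions
  (abc-iut-L4's `nonempty_iso_of_geom_map_eq`, [AbsTopIII] Rmk 1.11.1 (i)), whence the core extension, read back in `A`, `A′`;
* `PuncturedEllipticData.hext_of_cor_3_3_i`, `PuncturedEllipticData.hextC_of_cor_3_3_i` — the literal binders `hext`, `hextC`
  (ambient `P.PiC = Π_C`, `Q := P.piXarrow` resp. `P.piCarrow`).

## BINDER CENSUS (classes FACT-INSTANCE · DATA · DATUM-INTERNAL · LAW) for `hext_of_cor_3_3_i` (same for `hextC_…`)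

| binder | class | what it is in print |
|---|---|---|
| `𝒟`, `M`, `b b′`, `X X′` | DATA (model) | a class of construction data and a Cor 3.3 / 3.4 model over it whose members `X`, `X′` are `X̲→_K`, `X̲→_{K′}` ([AbsTopI] Ex 4.8 «applicable in light of») — NO instance of `EllipticModel` exists in the tree (model-relative typing of layer L4) |
| `h33 : M.Cor_3_3_i` | FACT-INSTANCE F-0294 | [AbsTopII] Cor 3.3 (i) as typed, BY NAME |
| `hfull : 𝒟.IsChainFull`, `hdgc : 𝒟.RelIsomDGC` | FACT-INSTANCE (𝒟-hypotheses of Cor 3.3; [AbsTopI] Def 4.6 / Ex 4.8) | «`𝒟` chain-full, rel-isom-DGC» |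
| `hX hX′ : M.IsCor33Member …` | DATUM-INTERNAL (standing hypotheses: `G` slim, `Δ` slim ≠ 1, elliptically admissible, cyclotomic character open) | Cor 3.3 p. 67 standing hypotheses at the members |
| `hS` | DATA | the two members carry the same prime set `Σ` (here: all primes) |
| `hmax hmax′ : GeomIsMaxTFGNormalIn ⊤` at the member extensions | FACT-INSTANCE ([AbsAnab] Lem 1.1.4 (i) F-0005 shape; over an NF base a THEOREM from `GeomTFG` via [AbsAnab] Thm 1.1.2 `galoisNF_tfgNormalSubgroup_trivial_holds`, cf. `PuncturedEllipticData.geomIsMaxTFGNormalIn_of_geomTFG`) | «recover `Δ_{X̲→} ⊆ Π_{X̲→}` via [AbsTopI] Thm 2.6 (v), (vi)» (p. 39 l. 23–24) |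
| `ePi eC hcomp` (+ primed) | DATA (realisation) | the identifications `Π_X = Π_{X̲→}`, `Π_C = D.geom.pe.PiC` compatible with `Π_{X̲→} ↪ Π_C` |

Net effect on the certificate: the ADAPTER-class binders `hext`, `hextC` become «F-0294 BY NAME at a model member + realisation
DATA + F-0005-shape instance»; they do NOT become closed theorems (the realisation data is not constructed in the tree).
HONEST FRAMING: binders are assumption labels; typed ≠ proved; nothing here bears on [IUTchIII] Cor 3.12 or asserts that abc
is proved or refuted.
-/

noncomputable section

open CategoryTheory Topology
open scoped Pointwise

universe u v

namespace Literature.IUT.HodgeTheaters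

open Literature.AlgebraicGeometry.Frobenioids (IsSlimGroup)
open Literature.AnabelianGeometry.AbsoluteAnabelian
open Literature.AnabelianGeometry.AbsoluteAnabelian.AbsTopI (ConstructionDataClass)
open Literature.AnabelianGeometry.AbsoluteAnabelian.AbsTopII (EllipticModel)

/-! ### The generic adapter: realised members of a Cor 3.3 model -/

/-- **[AbsTopII] Cor 3.3 (i) ⇒ the pure extension property for REALISED members.**  Let `M` be a Cor 3.3 / 3.4 model over a
class `𝒟` satisfying the `𝒟`-hypotheses and the named fact `M.Cor_3_3_i` (F-0294); let `X`, `X′` be members satisfying the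
standing hypotheses, with the same prime set, whose `Δ` is the maximal topologically finitely generated closed normal subgroup;
and let them be REALISED in ambient topological groups: `ePi : Π_X ≃ Q ⊆ A`, `eC : Π_C ≃ A` with `eC ∘ (Π_X ↪ Π_C) = ePi`
(likewise primed).  Then every bicontinuous group isomorphism `φ : Q ≃ Q′` extends to an isomorphism of topological groups
`Θ : A ≃ A′`.  ([AbsTopII] Cor 3.3 (i) + Rmk 3.3.2; [AbsTopIII] Rmk 1.11.1 (i) for the passage `φ ↦` isomorphism of extensions.)
[cite: MochizukiAbsTopII2013, Cor 3.3 (i) p.67] -/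
theorem exists_continuousMulEquiv_extending_of_cor_3_3_i
    {A : Type v} [Group A] [TopologicalSpace A] {A' : Type v} [Group A'] [TopologicalSpace A']
    {Q : Subgroup A} {Q' : Subgroup A'}
    {𝒟 : ConstructionDataClass.{u}} (M : EllipticModel 𝒟) (h33 : M.Cor_3_3_i) (hfull : 𝒟.IsChainFull)
    (hdgc : 𝒟.RelIsomDGC) {b b' : 𝒟.Base} {X : (𝒟.datum b).Obj} {X' : (𝒟.datum b').Obj}
    (hX : M.IsCor33Member b X) (hX' : M.IsCor33Member b' X') (hS : (𝒟.datum b').primes = (𝒟.datum b).primes)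
    (hmax : ((𝒟.datum b).ext X).GeomIsMaxTFGNormalIn ⊤) (hmax' : ((𝒟.datum b').ext X').GeomIsMaxTFGNormalIn ⊤)
    (ePi : ((𝒟.datum b).ext X).arith ≃ₜ* Q) (eC : (M.coreExt b X).arith ≃ₜ* A)
    (hcomp : ∀ x, eC ((M.toCore b X).arith x) = (ePi x : A))
    (ePi' : ((𝒟.datum b').ext X').arith ≃ₜ* Q') (eC' : (M.coreExt b' X').arith ≃ₜ* A')
    (hcomp' : ∀ x, eC' ((M.toCore b' X').arith x) = (ePi' x : A'))
    (φ : Q ≃* Q') (hφ : Continuous φ) (hφ' : Continuous φ.symm) :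
    ∃ Θ : A ≃ₜ* A', ∀ x : Q, Θ (x : A) = (φ x : A') := by
  let φc : Q ≃ₜ* Q' := { φ with continuous_toFun := hφ, continuous_invFun := hφ' }
  let ψ : ((𝒟.datum b).ext X).arith ≃ₜ* ((𝒟.datum b').ext X').arith := ePi.trans (φc.trans ePi'.symm)
  -- `ψ` carries `Δ` onto `Δ′` ([AbsAnab] Lem 1.1.4 (i) / [AbsTopII] Rmk 3.3.2), hence is an isomorphism of extensions
  have hψ : ((𝒟.datum b).ext X).geom.map ψ.toMulEquiv.toMonoidHom = ((𝒟.datum b').ext X').geom :=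
    FundamentalExtension.geom_map_eq_of_geomIsMaxTFGNormalIn hmax hmax' ψ
  obtain ⟨Φ, hΦ⟩ := FundamentalExtension.nonempty_iso_of_geom_map_eq ψ hψ
  -- [AbsTopII] Cor 3.3 (i), bi-anabelian form, at the members
  obtain ⟨Θ₀, hΘ₀⟩ := M.exists_coreIso_extending_of_cor_3_3_i h33 hfull hdgc hX hX' hS Φ
  refine ⟨eC.symm.trans (Θ₀.trans eC'), fun y => ?_⟩
  have hy : (y : A) = eC ((M.toCore b X).arith (ePi.symm y)) := by
    rw [hcomp, ContinuousMulEquiv.apply_symm_apply]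
  change eC' (Θ₀ (eC.symm (y : A))) = _
  rw [hy, ContinuousMulEquiv.symm_apply_apply, hΘ₀, hΦ, hcomp']
  change ((ePi' (ePi'.symm (φc (ePi (ePi.symm y)))) : Q') : A') = _
  rw [ContinuousMulEquiv.apply_symm_apply, ContinuousMulEquiv.apply_symm_apply]
  rfl

/-! ### The literal certificate binders `hext`, `hextC` at the §1 data -/

namespace PuncturedEllipticData

variable {P P' : PuncturedEllipticData.{v}} {𝒟 : ConstructionDataClass.{u}} (M : EllipticModel 𝒟)

/-- **`hext` of the [IUTchI] Cor 1.2 certificate conjunct FROM [AbsTopII] Cor 3.3 (i) as typed in L4**: if the open subgroups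
`Π_{X̲→} ⊆ Π_C`, `Π′_{X̲→} ⊆ Π′_C` of two §1 data `P`, `P′` REALISE members `X`, `X′` of a Cor 3.3 / 3.4 model `M` over `𝒟`
(«applicable in light of [AbsTopI], Example 4.8», p. 39 l. 25) with their `k`-cores realised by `Π_C`, `Π′_C`, then — given
F-0294 `M.Cor_3_3_i`, the `𝒟`-hypotheses, the standing hypotheses and `GeomIsMaxTFGNormalIn ⊤` at the two members — every
bicontinuous `φ : Π_{X̲→} ≃ Π′_{X̲→}` extends to `Θ : Π_C ≃ Π′_C` (the binder `hext` of
`Summit.ABC.IUTFork.Conditional.layer5_held_cor12_v6`, verbatim). ([IUTchI] Cor 1.2 p.39) [claim: Mochizuki2012, status: disputed] -/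
theorem hext_of_cor_3_3_i (h33 : M.Cor_3_3_i) (hfull : 𝒟.IsChainFull) (hdgc : 𝒟.RelIsomDGC)
    {b b' : 𝒟.Base} {X : (𝒟.datum b).Obj} {X' : (𝒟.datum b').Obj}
    (hX : M.IsCor33Member b X) (hX' : M.IsCor33Member b' X') (hS : (𝒟.datum b').primes = (𝒟.datum b).primes)
    (hmax : ((𝒟.datum b).ext X).GeomIsMaxTFGNormalIn ⊤) (hmax' : ((𝒟.datum b').ext X').GeomIsMaxTFGNormalIn ⊤)
    (ePi : ((𝒟.datum b).ext X).arith ≃ₜ* P.piXarrow) (eC : (M.coreExt b X).arith ≃ₜ* P.PiC)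
    (hcomp : ∀ x, eC ((M.toCore b X).arith x) = (ePi x : P.PiC))
    (ePi' : ((𝒟.datum b').ext X').arith ≃ₜ* P'.piXarrow) (eC' : (M.coreExt b' X').arith ≃ₜ* P'.PiC)
    (hcomp' : ∀ x, eC' ((M.toCore b' X').arith x) = (ePi' x : P'.PiC)) :
    ∀ φ : P.piXarrow ≃* P'.piXarrow, Continuous φ → Continuous φ.symm →
      ∃ Θ : P.PiC ≃ₜ* P'.PiC, ∀ x : P.piXarrow, Θ (x : P.PiC) = (φ x : P'.PiC) :=
  fun φ hφ hφ' =>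
    exists_continuousMulEquiv_extending_of_cor_3_3_i M h33 hfull hdgc hX hX' hS hmax hmax' ePi eC hcomp ePi' eC' hcomp'
      φ hφ hφ'

/-- **`hextC` of the [IUTchI] Cor 1.2 certificate conjunct FROM [AbsTopII] Cor 3.3 (i) as typed in L4**: the resp'd binder, for
the members `C̲→_K`, `C̲→_{K′}` (`Π_{C̲→} ⊆ Π_C` realising a member whose `k`-core is `Π_C`; hyperbolic orbicurves are allowed
as members). ([IUTchI] Cor 1.2 p.39) [claim: Mochizuki2012, status: disputed] -/
theorem hextC_of_cor_3_3_i (h33 : M.Cor_3_3_i) (hfull : 𝒟.IsChainFull) (hdgc : 𝒟.RelIsomDGC)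
    {b b' : 𝒟.Base} {Y : (𝒟.datum b).Obj} {Y' : (𝒟.datum b').Obj}
    (hY : M.IsCor33Member b Y) (hY' : M.IsCor33Member b' Y') (hS : (𝒟.datum b').primes = (𝒟.datum b).primes)
    (hmax : ((𝒟.datum b).ext Y).GeomIsMaxTFGNormalIn ⊤) (hmax' : ((𝒟.datum b').ext Y').GeomIsMaxTFGNormalIn ⊤)
    (ePi : ((𝒟.datum b).ext Y).arith ≃ₜ* P.piCarrow) (eC : (M.coreExt b Y).arith ≃ₜ* P.PiC)
    (hcomp : ∀ x, eC ((M.toCore b Y).arith x) = (ePi x : P.PiC))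
    (ePi' : ((𝒟.datum b').ext Y').arith ≃ₜ* P'.piCarrow) (eC' : (M.coreExt b' Y').arith ≃ₜ* P'.PiC)
    (hcomp' : ∀ x, eC' ((M.toCore b' Y').arith x) = (ePi' x : P'.PiC)) :
    ∀ ψ : P.piCarrow ≃* P'.piCarrow, Continuous ψ → Continuous ψ.symm →
      ∃ Θ : P.PiC ≃ₜ* P'.PiC, ∀ x : P.piCarrow, Θ (x : P.PiC) = (ψ x : P'.PiC) :=
  fun ψ hψ hψ' =>
    exists_continuousMulEquiv_extending_of_cor_3_3_i M h33 hfull hdgc hY hY' hS hmax hmax' ePi eC hcomp ePi' eC' hcomp'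
      ψ hψ hψ'

end PuncturedEllipticData

end Literature.IUT.HodgeTheaters

end
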